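/- Copyright: the b2b-balaban cell (near-miss cell 7), T⁴-continuum fan-out, lineage t4-ne7b-p1 (node U5c COUNT
member).  Released under the licence of the surrounding project. -/
import Summits.QuantumFields.BalabanUV.T4Continuum.Support.HistoryGenealogyDissolveWF
import Summits.QuantumFields.BalabanUV.T4Continuum.Support.HistoryGenealogyPedigreeRoot

/-!
# DISSOLVING THE FRESH CLUSTERS (junction M4, pass V, part 2a — leaf-first lists and the splice): the geometry of
leaf-first lists of domains (enumerations ending at a prescribed member, chains INTO a tail, one `S`-step) and the
list lemma «the splice keeps a leaf-first chain», on which part 2b's choice of the splice order rests (owner module of row NE7b, lineage `t4-ne7b-p1` gen 42; ruling R-OWNER-42-1 «pass V supersedes pass T» =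
R-OWNER-22-7 (α) at the junction; re-open object (α), `SCOPE-alpha.md` v2.3 §5 row M4, located open point G-M4-1 —
PRE-POSITIONING ONLY)

Summits-side support leaf of the T⁴-continuum cell (rung (B)+1 on a FINITE torus only; NOT infinite volume, NOT the
mass gap, NOT the Clay statement; NOT a proof of the spine estimate NE7b, which is the cell's OWN estimate, NOT PRINTED
and NOT PROVED).  [folklore] finite ℤᵈ index-model geometry and list combinatorics over parts 1a∕1b (`splice`,
`dissolve`, `Fresh`, `partV`, `SpliceOK`), row S14's `unionL`∕`ChainTouch`∕`imgC`, the greedy leaf-first enumeration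
of `HistoryGenealogyRealiseOrder` (re-run with a PRESCRIBED LAST member), brick 2c's `gconn_of_chainTouch`, the
Literature index model (`B16MergeGeometry`: `Touch`, `touchGraph`, `coarse_mem_Sop_of_touch`; `B16SProfile`: `Sop`,
`ratio`, `Sop_biUnion`; `Step.Budget.GConn`); nothing printed is asserted, no `def … : Prop` fact of Bałaban's
(`SplGood` is a displayed SPECIFICATION of our choice), no cite-tagged hypothesis, zero `sorry`.  B16 =
[Balaban1989LargeFieldII] p. 386 (the maximal-tree order) is a manuscript UNDER AUDIT; locators only.

WHAT.  §1 geometry of lists of domains: `chainTouch_cons_iff_of_ne_nil`, `unionL_append`, `unionL_map_perm`,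
`Sop_unionL`, **`exists_chainTouch_enum_last`** (a family with connected touch graph has a duplicate-free leaf-first
enumeration ENDING at any prescribed member), `chainTouch_map_Sop` (one `S`-step keeps a leaf-first chain: touching
domains have images sharing a cube); §2 **`CTL Y X`** («`X` is leaf-first INTO the tail `Y`») with
`chainTouch_append_iff`, `ctl_congr`, `ctl_append_singleton`, `ctl_singleton_of_split`; §3 **`chainTouch_splice`**: a
leaf-first list stays leaf-first after the splice when every replacement has the same union as the replaced image and
is leaf-first into its tail, `unionL_splice`, `append_cons_unique`.  Part 2b (`…DissolveSplice`): the displayed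
specification `SplGood` of a splice order, its existence from the history's own clauses, the choice `splOf`, and the
transports of (G-touch), (G-join) and the cover condition to the dissolved bookkeeping.

HONEST.  Proves nothing of Bałaban's; a re-indexing of OUR bookkeeping; by-name class of every `WALL-NE7b-P1.md` §2
binder UNCHANGED; NE7b NOT proved; spine 0∕9.  HONEST DEPENDENCY (cell): continuum YM on T⁴ ⇐ BetaPertH ∧ nine spine
estimates (0/9 proved); BetaPertH ⇐ (D1) ∧ (D4) ∧ CAP+tail; G-an2-4 gates asym, D1 and NE2/3/4.  This file changes none
of it. -/

open Finset
open Literature.MathematicalPhysics.QuantumFieldTheory.Balaban1983to89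
open Literature.MathematicalPhysics.QuantumFieldTheory.Balaban1983to89.B13ScaleTransfer
open Literature.MathematicalPhysics.QuantumFieldTheory.Balaban1983to89.B16SProfile
open Literature.MathematicalPhysics.QuantumFieldTheory.Balaban1983to89.B16MergeGeometry
open Literature.MathematicalPhysics.QuantumFieldTheory.Balaban1983to89.Step.Budget
open Summit.QuantumFields.BalabanUV.T4Continuum.HistoryGenealogyExtraction
open Summit.QuantumFields.BalabanUV.T4Continuum.HistoryGenealogyRealise
open Summit.QuantumFields.BalabanUV.T4Continuum.HistoryGenealogyPedigree

namespace Summit.QuantumFields.BalabanUV.T4Continuum.HistoryGenealogyExtraction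

noncomputable section

open Classical

variable {d : ℕ}

/-! ## §1 Lists of domains: unions, leaf-first chains, one `S`-step -/

section Geometry

variable {ι : Type*}

/-- `ChainTouch (A :: M)` for a nonempty tail, unfolded [folklore] -/
theorem chainTouch_cons_iff_of_ne_nil {A : Finset (Pt d)} {M : List (Finset (Pt d))} (hM : M ≠ []) :
    ChainTouch (A :: M) ↔ (∃ a ∈ A, ∃ c ∈ unionL M, Touch a c) ∧ ChainTouch M := by
  match M, hM with
  | B :: L, _ => exact chainTouch_cons_cons A B L

/-- the union of an appended list [folklore] -/
theorem unionL_append : ∀ X Y : List (Finset (Pt d)), unionL (X ++ Y) = unionL X ∪ unionL Y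
  | [], Y => by simp
  | A :: X, Y => by rw [List.cons_append, unionL_cons, unionL_cons, unionL_append X Y, Finset.union_assoc]

/-- the union of a mapped list is the finset union over its members [folklore] -/
theorem mem_unionL_map_iff (g : ι → Finset (Pt d)) {l : List ι} {x : Pt d} :
    x ∈ unionL (l.map g) ↔ ∃ i ∈ l, x ∈ g i := by
  rw [mem_unionL]
  constructor
  · rintro ⟨A, hA, hx⟩
    obtain ⟨i, hi, rfl⟩ := List.mem_map.1 hA
    exact ⟨i, hi, hx⟩
  · rintro ⟨i, hi, hx⟩
    exact ⟨g i, List.mem_map.2 ⟨i, hi, rfl⟩, hx⟩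

/-- the union of a mapped list depends on the members only (permutation invariance) [folklore] -/
theorem unionL_map_perm (g : ι → Finset (Pt d)) {l l' : List ι} (h : l.Perm l') : unionL (l.map g) = unionL (l'.map g) := by
  ext x
  rw [mem_unionL_map_iff, mem_unionL_map_iff]
  exact ⟨fun ⟨i, hi, hx⟩ => ⟨i, h.mem_iff.1 hi, hx⟩, fun ⟨i, hi, hx⟩ => ⟨i, h.mem_iff.2 hi, hx⟩⟩

/-- one `S`-step distributes over the union of a list [folklore] -/
theorem Sop_unionL (q : ℕ) (g : ι → Finset (Pt d)) :
    ∀ l : List ι, Sop q (unionL (l.map g)) = unionL (l.map fun i => Sop q (g i))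
  | [] => by
      rw [List.map_nil, List.map_nil, unionL_nil]
      have h := Sop_biUnion (d := d) q (∅ : Finset ℕ) (fun _ => ∅)
      simpa using h
  | i :: l => by
      rw [List.map_cons, List.map_cons, unionL_cons, unionL_cons, ← Sop_unionL q g l]
      have h := Sop_biUnion q ({true, false} : Finset Bool) (fun b => if b then g i else unionL (l.map g))
      have h1 : ({true, false} : Finset Bool).biUnion (fun b => if b then g i else unionL (l.map g)) =
          g i ∪ unionL (l.map g) := by simp
      have h2 : ({true, false} : Finset Bool).biUnion (fun b => Sop q (if b then g i else unionL (l.map g))) =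
          Sop q (g i) ∪ Sop q (unionL (l.map g)) := by simp
      rw [h1, h2] at h
      exact h

/-- touching domains have `S`-images that touch (they share the coarse image of the touching cube) [folklore] -/
theorem touch_Sop_of_touch {q : ℕ} (hq : 0 < q) {X Y : Finset (Pt d)} (h : ∃ a ∈ X, ∃ c ∈ Y, Touch a c) :
    ∃ a ∈ Sop q X, ∃ c ∈ Sop q Y, Touch a c := by
  obtain ⟨a, ha, c, hc, hac⟩ := h
  obtain ⟨h1, h2⟩ := coarse_mem_Sop_of_touch hq ha hc hac
  exact ⟨coarse q c, h1, coarse q c, h2, Touch.refl _⟩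

/-- **ONE `S`-STEP KEEPS A LEAF-FIRST CHAIN.** [folklore] -/
theorem chainTouch_map_Sop {q : ℕ} (hq : 0 < q) (g : ι → Finset (Pt d)) :
    ∀ l : List ι, ChainTouch (l.map g) → ChainTouch (l.map fun i => Sop q (g i))
  | [], _ => by simp
  | [i], _ => by simp
  | i :: i' :: l, h => by
      rw [List.map_cons, List.map_cons, chainTouch_cons_cons] at h
      obtain ⟨⟨a, ha, c, hc, hac⟩, hrest⟩ := h
      rw [List.map_cons, List.map_cons, chainTouch_cons_cons]
      refine ⟨?_, by have := chainTouch_map_Sop hq g (i' :: l) hrest; rwa [List.map_cons] at this⟩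
      obtain ⟨i₁, hi₁, hc₁⟩ := (mem_unionL_map_iff g (l := i' :: l)).1 hc
      obtain ⟨a', ha', c', hc', hac'⟩ := touch_Sop_of_touch hq ⟨a, ha, c, hc₁, hac⟩
      exact ⟨a', ha', c', (mem_unionL_map_iff (fun i => Sop q (g i)) (l := i' :: l)).2 ⟨i₁, hi₁, hc'⟩, hac'⟩

variable [DecidableEq ι]

/-- greedy leaf-first lists ENDING AT A PRESCRIBED MEMBER `v₀`: for every `1 ≤ k ≤ #S` a duplicate-free list
`l ++ [v₀]` of `k` members in `ChainTouch` order (grow by prepending a member adjacent to the list, as in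
`HistoryGenealogyRealiseOrder.exists_chainTouch_list_of_gconn`). [folklore] -/
theorem exists_chainTouch_list_last (P : ι → Finset (Pt d)) {S : Finset ι} (hG : GConn (touchGraph P) S) {v₀ : ι}
    (hv₀ : v₀ ∈ S) : ∀ k, 1 ≤ k → k ≤ S.card →
      ∃ l : List ι, (l ++ [v₀]).Nodup ∧ (∀ i ∈ l ++ [v₀], i ∈ S) ∧ (l ++ [v₀]).length = k ∧ ChainTouch ((l ++ [v₀]).map P)
  | 0, h, _ => absurd h (by omega)
  | 1, _, _ => ⟨[], List.nodup_singleton v₀, by simpa using hv₀, rfl, by simp⟩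
  | k + 2, _, hk => by
      obtain ⟨l, hnd, hsub, hlen, hct⟩ := exists_chainTouch_list_last P hG hv₀ (k + 1) (by omega) (by omega)
      set T : Finset ι := (l ++ [v₀]).toFinset with hT
      have hTS : T ⊆ S := fun i hi => hsub i (List.mem_toFinset.1 hi)
      have hcard : T.card = k + 1 := by rw [hT, List.toFinset_card_of_nodup hnd]; exact hlen
      obtain ⟨y, hyS, hyT⟩ := Finset.exists_mem_notMem_of_card_lt_card (s := T) (t := S) (by omega)
      obtain ⟨u', hu'T, v, hvS, hvT, hadj⟩ :=
        exists_adj_out_of_gconn P hG hTS (x := v₀) (List.mem_toFinset.2 (by simp)) hyS hyT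
      obtain ⟨-, a, ha, c, hc, hac⟩ := (touchGraph_adj P u' v).1 hadj
      have hv_notin : v ∉ l ++ [v₀] := fun h => hvT (List.mem_toFinset.2 h)
      refine ⟨v :: l, ?_, ?_, by simp [← hlen], ?_⟩
      · rw [List.cons_append]; exact List.nodup_cons.2 ⟨hv_notin, hnd⟩
      · intro i hi
        rw [List.cons_append, List.mem_cons] at hi
        rcases hi with rfl | hi
        · exact hvS
        · exact hsub i hi
      · rw [List.cons_append, List.map_cons]
        refine chainTouch_cons (by simp) ⟨c, hc, a, ?_, hac.symm⟩ hct
        exact subset_unionL_map P (List.mem_toFinset.1 hu'T) ha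

/-- **A LEAF-FIRST ENUMERATION ENDING AT ANY PRESCRIBED MEMBER EXISTS** for a family with connected touch graph.
[folklore] -/
theorem exists_chainTouch_enum_last (P : ι → Finset (Pt d)) {S : Finset ι} (hG : GConn (touchGraph P) S) {v₀ : ι}
    (hv₀ : v₀ ∈ S) : ∃ l : List ι, (l ++ [v₀]).Nodup ∧ (l ++ [v₀]).toFinset = S ∧ ChainTouch ((l ++ [v₀]).map P) := by
  have hpos : 1 ≤ S.card := Finset.card_pos.2 ⟨v₀, hv₀⟩
  obtain ⟨l, hnd, hsub, hlen, hct⟩ := exists_chainTouch_list_last P hG hv₀ S.card hpos le_rfl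
  refine ⟨l, hnd, Finset.eq_of_subset_of_card_le (fun i hi => hsub i (List.mem_toFinset.1 hi)) ?_, hct⟩
  rw [List.toFinset_card_of_nodup hnd, hlen]

end Geometry

/-! ## §2 Leaf-first INTO a tail -/

section Tail

/-- **`CTL Y X`**: every member of `X` touches the union of the later members of `X` and of the tail `Y`, whenever
something comes later (`ChainTouch (X ++ Y) ↔ CTL Y X ∧ ChainTouch Y`). [folklore] -/
def CTL (Y : List (Finset (Pt d))) : List (Finset (Pt d)) → Prop
  | [] => True
  | A :: X => (X ++ Y ≠ [] → ∃ a ∈ A, ∃ c ∈ unionL (X ++ Y), Touch a c) ∧ CTL Y X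

/-- `CTL` of the empty list [folklore] -/
@[simp] theorem ctl_nil (Y : List (Finset (Pt d))) : CTL Y [] := trivial

/-- `CTL` one step [folklore] -/
theorem ctl_cons (Y : List (Finset (Pt d))) (A : Finset (Pt d)) (X : List (Finset (Pt d))) :
    CTL Y (A :: X) ↔ (X ++ Y ≠ [] → ∃ a ∈ A, ∃ c ∈ unionL (X ++ Y), Touch a c) ∧ CTL Y X := Iff.rfl

/-- **APPENDED LEAF-FIRST CHAINS**: `X ++ Y` is leaf-first iff `X` is leaf-first into `Y` and `Y` is leaf-first.
[folklore] -/
theorem chainTouch_append_iff : ∀ X Y : List (Finset (Pt d)), ChainTouch (X ++ Y) ↔ CTL Y X ∧ ChainTouch Y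
  | [], Y => by simp
  | A :: X, Y => by
      rw [List.cons_append, ctl_cons]
      by_cases h : X ++ Y = []
      · obtain ⟨hX, hY⟩ := List.append_eq_nil_iff.1 h
        subst hX; subst hY
        simp
      · rw [chainTouch_cons_iff_of_ne_nil h, chainTouch_append_iff X Y]
        constructor
        · rintro ⟨h1, h2, h3⟩; exact ⟨⟨fun _ => h1, h2⟩, h3⟩
        · rintro ⟨⟨h1, h2⟩, h3⟩; exact ⟨h1 h, h2, h3⟩

/-- `CTL` depends on the tail only through its union and its emptiness [folklore] -/
theorem ctl_congr {Y Y' : List (Finset (Pt d))} (hU : unionL Y = unionL Y') (he : Y = [] ↔ Y' = []) :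
    ∀ X : List (Finset (Pt d)), CTL Y X ↔ CTL Y' X
  | [] => by simp
  | A :: X => by
      rw [ctl_cons, ctl_cons, ctl_congr hU he X, unionL_append, unionL_append, hU]
      have : (X ++ Y ≠ []) ↔ (X ++ Y' ≠ []) := by
        rw [not_iff_not]
        simp only [List.append_eq_nil_iff, he]
      rw [this]

/-- a leaf-first list whose LAST member touches the tail's union is leaf-first into the tail [folklore] -/
theorem ctl_append_singleton (Y : List (Finset (Pt d))) :
    ∀ (X : List (Finset (Pt d))) (B : Finset (Pt d)), ChainTouch (X ++ [B]) →
      (Y ≠ [] → ∃ a ∈ B, ∃ c ∈ unionL Y, Touch a c) → CTL Y (X ++ [B])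
  | [], B, _, h => by
      rw [List.nil_append, ctl_cons]
      exact ⟨fun hY => by rw [List.nil_append] at hY ⊢; exact h hY, trivial⟩
  | A :: X, B, hct, h => by
      rw [List.cons_append] at hct ⊢
      rw [chainTouch_cons_iff_of_ne_nil (by simp)] at hct
      rw [ctl_cons]
      refine ⟨fun _ => ?_, ctl_append_singleton Y X B hct.2 h⟩
      obtain ⟨a, ha, c, hc, hac⟩ := hct.1
      refine ⟨a, ha, c, ?_, hac⟩
      rw [unionL_append]
      exact Finset.mem_union_left _ hc

/-- in a leaf-first list, a member read as a one-element block is leaf-first into what follows it [folklore] -/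
theorem ctl_singleton_of_split {α : Type*} (f : α → Finset (Pt d)) :
    ∀ (l₁ : List α) (x : α) (l₂ : List α), ChainTouch ((l₁ ++ x :: l₂).map f) → CTL (l₂.map f) [f x]
  | [], x, l₂, h => by
      rw [List.nil_append, List.map_cons] at h
      rw [ctl_cons, List.nil_append]
      refine ⟨fun hne => ((chainTouch_cons_iff_of_ne_nil hne).1 h).1, trivial⟩
  | y :: l₁, x, l₂, h => by
      rw [List.cons_append, List.map_cons, chainTouch_cons_iff_of_ne_nil (by simp)] at h
      exact ctl_singleton_of_split f l₁ x l₂ h.2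

end Tail

/-! ## §3 The splice keeps leaf-first chains and unions -/

section Splice

variable {α β : Type*}

/-- a splice with nonempty replacements is empty iff the list is [folklore] -/
theorem splice_eq_nil_iff {pV : α → List α} (h : ∀ p, pV p ≠ []) {l : List (α ⊕ β)} : splice pV l = [] ↔ l = [] := by
  constructor
  · intro he
    have := length_le_length_splice h l
    rw [he, List.length_nil, Nat.le_zero, List.length_eq_zero_iff] at this
    exact this
  · rintro rfl; rfl

/-- **THE UNION OF A SPLICED LIST** is the union of the list when every replacement has the union of the replaced
image. [folklore] -/
theorem unionL_splice (f : α ⊕ β → Finset (Pt d)) (pV : α → List α)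
    (hU : ∀ p, unionL ((pV p).map fun q => f (Sum.inl q)) = f (Sum.inl p)) :
    ∀ l : List (α ⊕ β), unionL ((splice pV l).map f) = unionL (l.map f)
  | [] => rfl
  | Sum.inl p :: l => by
      rw [splice_cons_inl, List.map_append, unionL_append, List.map_map, List.map_cons, unionL_cons,
        unionL_splice f pV hU l]
      congr 1
      rw [← hU p]
      rfl
  | Sum.inr n :: l => by
      rw [splice_cons_inr, List.map_cons, List.map_cons, unionL_cons, unionL_cons, unionL_splice f pV hU l]

/-- **THE SPLICE KEEPS A LEAF-FIRST CHAIN** when the replacements are nonempty, keep unions, and each replacement of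
a listed old part is leaf-first into the images listed after it. [folklore] -/
theorem chainTouch_splice (f : α ⊕ β → Finset (Pt d)) (pV : α → List α) (hne : ∀ p, pV p ≠ [])
    (hU : ∀ p, unionL ((pV p).map fun q => f (Sum.inl q)) = f (Sum.inl p)) :
    ∀ l : List (α ⊕ β), ChainTouch (l.map f) →
      (∀ (l₁ : List (α ⊕ β)) (p : α) (l₂ : List (α ⊕ β)), l = l₁ ++ Sum.inl p :: l₂ →
        CTL (l₂.map f) ((pV p).map fun q => f (Sum.inl q))) →
      ChainTouch ((splice pV l).map f)
  | [], _, _ => by simp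
  | Sum.inr n :: l, hct, hgood => by
      rw [splice_cons_inr, List.map_cons]
      by_cases hl : l = []
      · subst hl; simp
      · have hsl : (splice pV l).map f ≠ [] := by
          intro he; exact hl ((splice_eq_nil_iff hne).1 (List.map_eq_nil_iff.1 he))
        rw [chainTouch_cons_iff_of_ne_nil hsl, unionL_splice f pV hU l]
        rw [List.map_cons, chainTouch_cons_iff_of_ne_nil (by intro he; exact hl (List.map_eq_nil_iff.1 he))] at hct
        exact ⟨hct.1, chainTouch_splice f pV hne hU l hct.2 fun l₁ p l₂ h => hgood (Sum.inr n :: l₁) p l₂ (by rw [h]; rfl)⟩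
  | Sum.inl p :: l, hct, hgood => by
      rw [splice_cons_inl, List.map_append, List.map_map, chainTouch_append_iff]
      have hct' : ChainTouch (l.map f) := by
        by_cases hl : l = []
        · subst hl; simp
        · rw [List.map_cons, chainTouch_cons_iff_of_ne_nil (by intro he; exact hl (List.map_eq_nil_iff.1 he))] at hct
          exact hct.2
      refine ⟨?_, chainTouch_splice f pV hne hU l hct' fun l₁ p' l₂ h => hgood (Sum.inl p :: l₁) p' l₂ (by rw [h]; rfl)⟩
      have hg := hgood [] p l (by simp)
      have he : (l.map f = []) ↔ ((splice pV l).map f = []) := by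
        rw [List.map_eq_nil_iff, List.map_eq_nil_iff, splice_eq_nil_iff hne]
      exact (ctl_congr (unionL_splice f pV hU l).symm he _).1 hg

/-- decompositions at a member of a duplicate-free list are unique [folklore] -/
theorem append_cons_unique {γ : Type*} {x : γ} :
    ∀ {l₁ l₁' l₂ l₂' : List γ}, l₁ ++ x :: l₂ = l₁' ++ x :: l₂' → (l₁ ++ x :: l₂).Nodup → l₁ = l₁' ∧ l₂ = l₂'
  | [], [], l₂, l₂', h, _ => by simpa using h
  | [], y :: l₁', l₂, l₂', h, hnd => by
      rw [List.nil_append, List.cons_append] at h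
      obtain ⟨rfl, rfl⟩ := List.cons.inj h
      rw [List.nil_append, List.nodup_cons] at hnd
      exact absurd (List.mem_append_right _ List.mem_cons_self) hnd.1
  | y :: l₁, [], l₂, l₂', h, hnd => by
      rw [List.nil_append, List.cons_append] at h
      obtain ⟨rfl, hrest⟩ := List.cons.inj h
      rw [List.cons_append, List.nodup_cons] at hnd
      exact absurd (List.mem_append_right _ List.mem_cons_self) hnd.1
  | y :: l₁, y' :: l₁', l₂, l₂', h, hnd => by
      rw [List.cons_append, List.cons_append] at h
      obtain ⟨rfl, hrest⟩ := List.cons.inj h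
      rw [List.cons_append, List.nodup_cons] at hnd
      obtain ⟨h1, h2⟩ := append_cons_unique hrest hnd.2
      exact ⟨by rw [h1], h2⟩

end Splice

end

end Summit.QuantumFields.BalabanUV.T4Continuum.HistoryGenealogyExtraction
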